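import Summits.QuantumFields.YangMills.Theorems.VirialFluxGapResolventFieldGenericScaled
import HarnessLib

/-!
# Route `VirialFluxGap` (YangMills): the RESOLVENT EULER FIELD — the frame derivatives of the frame Hessian (`B_i = ∂_{τ_i}H`) are bounded
# by the trilinear third-derivative constant: `|B_i v|² ≤ (#ι·K)²|v|²` (hypothesis `hB` of the divergence estimate)

Toward the deciding crux `VirialFluxGap.PeriodicSoftness` (item stmt-QuantumFields-24141), generic-region Euler field `X_g = ½(H+λ⋆)⁻¹g` on
the host `X_fix` (memo `fcl-p3-g40-RESOLVENT-EULER-FIELD-24141.md`).  In the closed form of the divergence (✓`sum_frameD_resolventCoeff`) the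
correction term carries the matrices `B_i = (∂_{τ_i}H_{j'k})_{j'k}`; the master estimate ✓`generic_divergence_upper` asks for `hB :
|B_i v|² ≤ b²|v|²`.  This file discharges `hB` from the frame-free trilinear bound `hK3` (✓`exists_bound_frameD3_ringPoly`, `K = C·L⁴`) for
any frame family with slot norms `≤ 1` (w2's ✓`fixFrameStd`, ✓`stdFrame`), with `b = #ι·K`:

* §1 `frameD_fun_add`, `frameD_frameHess_entry` (`∂_iH_{jk} = ½(∂_i∂_j∂_kF + ∂_i∂_k∂_jF)`), `abs_frameD_frameHess_entry_le` (`≤ K` at ring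
  histories), `mulVec_sq_le_of_abs_entry_le` (`|A_{jk}| ≤ a ⇒ |Av|² ≤ (#ι·a)²|v|²`);
* §2 ★★ `frameHess_frameDeriv_sq_le`: `hB` verbatim with `b = #ι·K`.

HONEST LABEL: one hypothesis discharged; the Euler field is NOT assembled; ⟨24141⟩, ⟨22884⟩ remain OPEN; the Yang–Mills mass gap is NOT
proved; no summit is proved by a line.  THEOREMS ONLY (0 `def`, 0 `sorry`), standard axioms.  Explicit-unit seat `ym-line-fcl-p3` g40
(cell ym-idea-1, free hands), `--supports stmt-QuantumFields-24141`.  References: [folklore].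
-/

set_option autoImplicit false

noncomputable section

open scoped Matrix BigOperators ContDiff Topology
open MeasureTheory Set Matrix
open Literature.MathematicalPhysics.QuantumFieldTheory hiding SU2
open Literature.MathematicalPhysics.QuantumLattice
open Literature.MathematicalPhysics.QuantumFieldTheory.SUNBakryEmery (expSU coe_expSU matTop)

namespace Summit.QuantumFields.YangMills.Theorems.VirialFluxGap.FrameHessian

open Summit.QuantumFields.YangMills.Theorems.FemtoTransferGap
open Summit.QuantumFields.YangMills.Theorems.FemtoTransferGap.TT
open Summit.QuantumFields.YangMills.Theorems.VirialFluxGap.RingDeficit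
open Summit.QuantumFields.YangMills.Theorems.VirialFluxGap.FrameDerivative
open Summit.QuantumFields.YangMills.Theorems.VirialFluxGap.ResolventField

variable {L : ℕ} [NeZero L]
variable {ι : Type*} [Fintype ι]

open scoped Matrix.Norms.Frobenius

attribute [local instance 2000] Literature.MathematicalPhysics.QuantumFieldTheory.SUNBakryEmery.matTop

/-! ## §1 Letters -/

omit [Fintype ι] in
/-- The frame derivative of a sum of two smooth functions. [folklore] -/
theorem frameD_fun_add (Y : ((Fin (2 * L - 1 + 1) × Edge 3 L) ⊕ Site 3 L) → Matrix (Fin 2) (Fin 2) ℂ) {f g : ((Fin (2 * L - 1 + 1) → Edge 3 L → Matrix (Fin 2) (Fin 2) ℂ) × (Site 3 L → Matrix (Fin 2) (Fin 2) ℂ)) → ℝ} (hf : ContDiff ℝ ∞ f) (hg : ContDiff ℝ ∞ g) (M : ((Fin (2 * L - 1 + 1) → Edge 3 L → Matrix (Fin 2) (Fin 2) ℂ) × (Site 3 L → Matrix (Fin 2) (Fin 2) ℂ))) :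
    frameD Y (fun M' => f M' + g M') M = frameD Y f M + frameD Y g M := by
  unfold frameD
  have hdf : DifferentiableAt ℝ f M := (hf.differentiable (by simp)).differentiableAt
  have hdg : DifferentiableAt ℝ g M := (hg.differentiable (by simp)).differentiableAt
  rw [show (fun M' => f M' + g M') = f + g from rfl, fderiv_add hdf hdg, _root_.add_apply]

omit [Fintype ι] in
/-- ★ The frame derivative of a symmetrised Hessian entry is the symmetrised third frame derivative:
`∂_{τ_i}H_{jk} = ½(∂_i∂_j∂_k F + ∂_i∂_k∂_j F)`. [folklore] -/
theorem frameD_frameHess_entry (τ : ι → ((Fin (2 * L - 1 + 1) × Edge 3 L) ⊕ Site 3 L) → Matrix (Fin 2) (Fin 2) ℂ) (i j k : ι) (M : ((Fin (2 * L - 1 + 1) → Edge 3 L → Matrix (Fin 2) (Fin 2) ℂ) × (Site 3 L → Matrix (Fin 2) (Fin 2) ℂ))) :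
    frameD (τ i) (fun M' => frameHess (L := L) τ M' j k) M =
      (1 / 2) * (frameD (τ i) (frameD (τ j) (frameD (τ k) (ringPoly L))) M + frameD (τ i) (frameD (τ k) (frameD (τ j) (ringPoly L))) M) := by
  have h1 : (fun M' => frameHess (L := L) τ M' j k) = fun M' => (1 / 2) * (frameHessRaw (L := L) τ M' j k + frameHessRaw (L := L) τ M' k j) := rfl
  have hjk : ContDiff ℝ ∞ fun M' => frameHessRaw (L := L) τ M' j k := contDiff_frameHessRaw τ j k
  have hkj : ContDiff ℝ ∞ fun M' => frameHessRaw (L := L) τ M' k j := contDiff_frameHessRaw τ k j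
  rw [h1, frameD_const_mul (τ i) (hjk.add hkj), frameD_fun_add (τ i) hjk hkj]
  rfl

omit [Fintype ι] in
/-- At ring histories the frame derivatives of the Hessian entries are bounded by the trilinear constant: `|∂_{τ_i}H_{jk}(ringCoord Q)| ≤ K`
for slot norms `≤ 1`. [folklore] -/
theorem abs_frameD_frameHess_entry_le {τ : ι → ((Fin (2 * L - 1 + 1) × Edge 3 L) ⊕ Site 3 L) → Matrix (Fin 2) (Fin 2) ℂ} (hτn : ∀ j w, ‖τ j w‖ ≤ 1) {K : ℝ}
    (hK3 : ∀ (Y₁ Y₂ Y₃ : ((Fin (2 * L - 1 + 1) × Edge 3 L) ⊕ Site 3 L) → Matrix (Fin 2) (Fin 2) ℂ) (b₁ b₂ b₃ : ℝ), 0 ≤ b₁ → 0 ≤ b₂ → 0 ≤ b₃ →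
      (∀ w, ‖Y₁ w‖ ≤ b₁) → (∀ w, ‖Y₂ w‖ ≤ b₂) → (∀ w, ‖Y₃ w‖ ≤ b₃) → ∀ Q : ((Fin (2 * L - 1 + 1) → GaugeConfig 3 L SU2) × (Site 3 L → SU2)),
      |frameD Y₁ (frameD Y₂ (frameD Y₃ (ringPoly L))) (ringCoord L Q)| ≤ K * b₁ * b₂ * b₃)
    (i j k : ι) (Q : ((Fin (2 * L - 1 + 1) → GaugeConfig 3 L SU2) × (Site 3 L → SU2))) :
    |frameD (τ i) (fun M' => frameHess (L := L) τ M' j k) (ringCoord L Q)| ≤ K := by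
  rw [frameD_frameHess_entry]
  have h1 := hK3 (τ i) (τ j) (τ k) 1 1 1 zero_le_one zero_le_one zero_le_one (hτn i) (hτn j) (hτn k) Q
  have h2 := hK3 (τ i) (τ k) (τ j) 1 1 1 zero_le_one zero_le_one zero_le_one (hτn i) (hτn k) (hτn j) Q
  simp only [mul_one] at h1 h2
  rw [abs_mul, abs_of_pos (by norm_num : (0 : ℝ) < 1 / 2)]
  have h3 := abs_add_le (frameD (τ i) (frameD (τ j) (frameD (τ k) (ringPoly L))) (ringCoord L Q))
    (frameD (τ i) (frameD (τ k) (frameD (τ j) (ringPoly L))) (ringCoord L Q))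
  linarith

/-- A matrix with entries bounded by `a` in absolute value satisfies `|Av|² ≤ (#ι·a)²·|v|²`. [folklore] -/
theorem mulVec_sq_le_of_abs_entry_le {A : Matrix ι ι ℝ} {a : ℝ} (ha : 0 ≤ a) (hA : ∀ j k, |A j k| ≤ a) (v : ι → ℝ) :
    (A *ᵥ v) ⬝ᵥ (A *ᵥ v) ≤ ((Fintype.card ι : ℝ) * a) ^ 2 * (v ⬝ᵥ v) := by
  classical
  have hrow : ∀ j, |(A *ᵥ v) j| ≤ a * ∑ k, |v k| := by
    intro j
    rw [mulVec, dotProduct]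
    calc |∑ k, A j k * v k| ≤ ∑ k, |A j k * v k| := Finset.abs_sum_le_sum_abs _ _
      _ = ∑ k, |A j k| * |v k| := Finset.sum_congr rfl fun k _ => abs_mul _ _
      _ ≤ ∑ k, a * |v k| := Finset.sum_le_sum fun k _ => mul_le_mul_of_nonneg_right (hA j k) (abs_nonneg _)
      _ = a * ∑ k, |v k| := by rw [Finset.mul_sum]
  have hl0 : 0 ≤ ∑ k, |v k| := Finset.sum_nonneg fun k _ => abs_nonneg _
  have hsq : ∀ j, (A *ᵥ v) j * (A *ᵥ v) j ≤ (a * ∑ k, |v k|) ^ 2 := by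
    intro j
    have h := hrow j
    have h0 : 0 ≤ a * ∑ k, |v k| := mul_nonneg ha hl0
    rw [← sq, ← sq_abs]
    exact pow_le_pow_left₀ (abs_nonneg _) h 2
  have hcs := sum_abs_sq_le v
  calc (A *ᵥ v) ⬝ᵥ (A *ᵥ v) = ∑ j, (A *ᵥ v) j * (A *ᵥ v) j := rfl
    _ ≤ ∑ _j : ι, (a * ∑ k, |v k|) ^ 2 := Finset.sum_le_sum fun j _ => hsq j
    _ = (Fintype.card ι : ℝ) * (a ^ 2 * (∑ k, |v k|) ^ 2) := by rw [Finset.sum_const, Finset.card_univ, nsmul_eq_mul]; ring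
    _ ≤ (Fintype.card ι : ℝ) * (a ^ 2 * (Fintype.card ι * (v ⬝ᵥ v))) :=
        mul_le_mul_of_nonneg_left (mul_le_mul_of_nonneg_left hcs (sq_nonneg _)) (Nat.cast_nonneg _)
    _ = ((Fintype.card ι : ℝ) * a) ^ 2 * (v ⬝ᵥ v) := by ring

/-! ## §2 The hypothesis `hB` of the divergence estimate -/

/-- ★★ **`hB` from `hK3`.**  For a frame family with slot norms `≤ 1` and the trilinear third-derivative bound `K`, the matrices
`B_i = (∂_{τ_i}H_{j'k}(ringCoord Q))_{j'k}` of ✓`sum_frameD_resolventCoeff` satisfy `|B_i v|² ≤ (#ι·K)²·|v|²` — hypothesis `hB` of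
✓`generic_divergence_upper` with `b = #ι·K`. [folklore] -/
theorem frameHess_frameDeriv_sq_le {τ : ι → ((Fin (2 * L - 1 + 1) × Edge 3 L) ⊕ Site 3 L) → Matrix (Fin 2) (Fin 2) ℂ} (hτn : ∀ j w, ‖τ j w‖ ≤ 1) {K : ℝ} (hK : 0 ≤ K)
    (hK3 : ∀ (Y₁ Y₂ Y₃ : ((Fin (2 * L - 1 + 1) × Edge 3 L) ⊕ Site 3 L) → Matrix (Fin 2) (Fin 2) ℂ) (b₁ b₂ b₃ : ℝ), 0 ≤ b₁ → 0 ≤ b₂ → 0 ≤ b₃ →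
      (∀ w, ‖Y₁ w‖ ≤ b₁) → (∀ w, ‖Y₂ w‖ ≤ b₂) → (∀ w, ‖Y₃ w‖ ≤ b₃) → ∀ Q : ((Fin (2 * L - 1 + 1) → GaugeConfig 3 L SU2) × (Site 3 L → SU2)),
      |frameD Y₁ (frameD Y₂ (frameD Y₃ (ringPoly L))) (ringCoord L Q)| ≤ K * b₁ * b₂ * b₃)
    (Q : ((Fin (2 * L - 1 + 1) → GaugeConfig 3 L SU2) × (Site 3 L → SU2))) (i : ι) (v : ι → ℝ) :
    ((fun j' k => frameD (τ i) (fun M => frameHess (L := L) τ M j' k) (ringCoord L Q)) *ᵥ v) ⬝ᵥ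
        ((fun j' k => frameD (τ i) (fun M => frameHess (L := L) τ M j' k) (ringCoord L Q)) *ᵥ v) ≤
      ((Fintype.card ι : ℝ) * K) ^ 2 * (v ⬝ᵥ v) :=
  mulVec_sq_le_of_abs_entry_le (A := fun j' k => frameD (τ i) (fun M => frameHess (L := L) τ M j' k) (ringCoord L Q)) hK
    (fun j' k => abs_frameD_frameHess_entry_le hτn hK3 i j' k Q) v

end Summit.QuantumFields.YangMills.Theorems.VirialFluxGap.FrameHessian

end
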